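import Literature.Probability.Percolation.IsoradialArmComparisonProofs
import Literature.Probability.LatticeModels.IsoradialGraphsProofs
import HarnessLib

/-!
# Alternating-arm comparability (GM 2014, Prop. 8.1, `k = 2j ≥ 4`): the assembly step of §8.1, proved

Proofs-only companion (D-0026: theorems only, no definition, no named fact) of
`Literature.Probability.Percolation.IsoradialArmComparison`, whose named fact
`GrimmettManolescu2014_altArmComparability` (call it `T`) is Grimmett–Manolescu, *Bond
percolation on isoradial graphs: criticality and universality*, PTRF 159 (2014) 273–327 =
arXiv:1204.0505, §8.1 Prop. 22 (`exp_transport`) for the alternating events `k = 2j ≥ 4`, on the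
tree's `embAltArmEvent`. The sibling files `IsoradialArmComparisonProofs` (inclusion halves of
Prop. 23 (a), (b)) and `IsoradialAltArmLocality` (locality, measurability, disjoint-annulus
independence, sub-multiplicativity) record bottom-up pieces of the printed proof. THIS file is
the *top-down* piece: the last paragraph of each of the transport proofs of §8.3–8.4, where the
scale distortion produced by the star–triangle transport is removed "by (exp_equiv_a) and
(exp_equiv_b), iterated" (arXiv p. 24, proof of Lemma 24, twice; p. 25, proof of Lemma 26, twice;
p. 26, proof of Prop. 23 (c), twice), and the assembly "This lemma, together with Corollary 25,
implies Proposition 22" (§8.4).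

## What is proved

* `ArmIteration.iterate_outer`, `ArmIteration.iterate_inner` — for any `P : ℕ → ℕ → ℝ` and
  `c ≥ 0`: the one-step bounds `P(N, n) ≤ c P(N, 2n)` (resp. `P(2N, n) ≤ c P(N, n)`), valid for
  `N ≥ N₀`, `n ≥ c₀ N`, iterate to `P(N, m) ≤ c^b P(N, 2^b m)` and `P(2^a N, n) ≤ c^a P(N, n)`.
* `ArmIteration.distortion` — **"(exp_equiv_a)–(b) iterated"**: if moreover `P` is monotone under
  shrinking of the annulus (`P(r, R) ≤ P(r', R')` for `r ≤ r' ≤ R' ≤ R`: the inclusion halves),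
  then for every integer distortion factor `L ≥ 1`,
  `P(L N, ⌊n / L⌋) ≤ c^{2L+1} P(N, n)` for `N ≥ max(N₀, 1)` and `n ≥ L 2^L (c₀ + 2) N` — an
  annulus shrunk by a bounded factor from both sides is at most a bounded factor likelier to be
  crossed. Pure bookkeeping on real numbers; no probability.
* `RhombicEmbedding.embAltArmProb_distortion` — the same for
  `P(r, R) = P_G[embAltArmEvent j r R]`, whose monotonicity is
  `RhombicEmbedding.embAltArmProb_mono_annulus` (`IsoradialArmComparisonProofs`), *given* the deep
  halves of Prop. 23 (a), (b) for that `G` as hypotheses.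
* `GrimmettManolescu2014_altArmComparability.of_equiv_of_transport` — **`T` follows from the two
  printed intermediate results of §8, in the tree's rendering, taken as explicit hypotheses**:
  (E) Prop. 23 (`exp_equiv`) (a), (b), second inequalities, for `embAltArmEvent j`, with constants
  uniform over the centred graphs of `𝒢(ε, I)` — `P_G[A(N, n)] ≤ c P_G[A(N, 2n)]` and
  `P_G[A(2N, n)] ≤ c P_G[A(N, n)]` for `N ≥ N₀`, `n ≥ c₀ N`; and (Tr) the *raw* output of the
  star–triangle transport of Lemma 26 composed with Cor. 25 (arXiv p. 25: "this implies that
  `ω^M ∈ Ã_k(N, c_d^{-1} n)`", whence `P_G[A_k(N, n)] ≤ c₃ P_{α,β}[A_k(c_d N, c_d^{-1} n)]`, and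
  conversely), i.e. comparability with `ℤ²` *up to a distortion of both radii by a bounded factor*
  `L` (the metric-comparison constant `c_d` of (4.4), composed over the three transport steps
  `G → G_{α,β} → G_{α,β₀} → G_{0,π/2}` and rounded up to an integer):
  `P_G[A(N, n)] ≤ C P_{ℤ²}[A(L N, ⌊n/L⌋)]` and `P_{ℤ²}[A(N, n)] ≤ C P_G[A(L N, ⌊n/L⌋)]`. The proof
  applies `distortion` to `ℤ²` (which lies in `𝒢(π/4, 1)`: `zdGraph_preconnected_holds`,
  `isIsoradial_squareLatticeEmbedding_holds`, `isRhombicTiling_squareLatticeEmbedding_holds`,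
  `hasBoundedAngles_squareLatticeEmbedding_holds`, `squareGridPropertyGM_squareLattice`,
  `squareLatticeEmbedding_z_zero`) for the upper bound and to `G` itself for the lower bound.
* `GrimmettManolescu2014_altArmComparability.transport_of` — conversely `T` gives (Tr) with
  `L = 1`: the reduction loses nothing.

## What is NOT proved, and where the debt sits (census of the discharge of `T`)

Neither hypothesis of `of_equiv_of_transport` is available in the tree, and each is a theory:
(E) is proved in the source (§8.5.2, "follow from Theorem 27 (separation) and the box-crossing
property; the proof, omitted here, is essentially that of [Nolin]") from the separation theorem
(Thm. 27, whose own "proof is omitted, and may be constructed via careful readings of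
[Kesten87, Nolin]"), the extended Harris–FKG inequality and BXP(δ(ε, I)) — the last being the
unproved named fact `gm_boxCrossingBounds_uniform` of `Isoradial.lean` (§8.5.1: "By Theorem 3.1,
`P_G` satisfies BXP(δ) with `δ = δ(ε, I)`"); (Tr) is §8.3–8.4 (track exchanges `Σ_j` of §5.3
acting on the isoradial square lattices `G_{α,β̃^m}`, the grid sliding `R^±` of §7 through
SGP(I) clause (b), "clusters neither break nor merge", Prop. 23 (c) and the metric comparison
(4.4)), of which the tree has the single-move probabilistic core (`StarTriangleMoves.ConnEquiv`)
and the lattices `G_{α,β}` (`IsoradialSquareLatticeGM`) but not the track-exchange operators. No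
named fact is introduced for either (D-0026); they are binder types of the reduction theorem.

## References

* G. R. Grimmett, I. Manolescu, *Bond percolation on isoradial graphs: criticality and
  universality*, PTRF 159 (2014) 273–327, arXiv:1204.0505: §8.1 (Prop. 22 and the outline),
  §8.2 (Prop. 23 (a)–(c)), §8.3 (Lemma 24, Cor. 25: "by (exp_equiv_a) and (exp_equiv_b),
  iterated"), §8.4 (Lemma 26: "This lemma, together with Corollary 25, implies Proposition 22"),
  §8.5 (Thm. 27, proof of Prop. 23), §4.4 (4.4) (the constant `c_d`).
* H. Kesten, *Scaling relations for 2D-percolation*, Comm. Math. Phys. 109 (1987) 109–156;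
  P. Nolin, *Near-critical percolation in two dimensions*, EJP 13 (2008) 1562–1623, §4
  (separation and extension of arms).
-/

noncomputable section

open MeasureTheory

namespace Literature.Probability.Percolation

open LatticeModels Percolation

/-! ### "(exp_equiv_a)–(b) iterated": real bookkeeping -/

namespace ArmIteration

/-- **Iterating the outer-radius doubling bound.** If `P(N, n) ≤ c P(N, 2n)` whenever `N ≥ N₀`
and `n ≥ c₀ N`, then `P(N, m) ≤ c^b P(N, 2^b m)` for all `b`, `N ≥ N₀`, `m ≥ c₀ N`
(Grimmett–Manolescu 2014, §8.3: "(exp_equiv_a) … iterated").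
[cite: GrimmettManolescu2014Isoradial, §8.2 Prop. 23 (a) and §8.3 proof of Lemma 24 (iteration)] -/
theorem iterate_outer {P : ℕ → ℕ → ℝ} {c : ℝ} (hc : 0 ≤ c) {N₀ c₀ : ℕ}
    (ha : ∀ N n : ℕ, N₀ ≤ N → c₀ * N ≤ n → P N n ≤ c * P N (2 * n)) :
    ∀ b N m : ℕ, N₀ ≤ N → c₀ * N ≤ m → P N m ≤ c ^ b * P N (2 ^ b * m) := by
  intro b
  induction b with
  | zero => intro N m _ _; simp
  | succ b ih =>
    intro N m hN hm
    have hm' : c₀ * N ≤ 2 ^ b * m := hm.trans (Nat.le_mul_of_pos_left m (by positivity))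
    have h2 : P N (2 ^ b * m) ≤ c * P N (2 ^ (b + 1) * m) := by
      have h := ha N (2 ^ b * m) hN hm'
      have e : 2 * (2 ^ b * m) = 2 ^ (b + 1) * m := by ring
      rwa [e] at h
    calc P N m ≤ c ^ b * P N (2 ^ b * m) := ih N m hN hm
      _ ≤ c ^ b * (c * P N (2 ^ (b + 1) * m)) := mul_le_mul_of_nonneg_left h2 (pow_nonneg hc b)
      _ = c ^ (b + 1) * P N (2 ^ (b + 1) * m) := by ring

/-- **Iterating the inner-radius doubling bound.** If `P(2N, n) ≤ c P(N, n)` whenever `N ≥ N₀`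
and `n ≥ c₀ N`, then `P(2^a N, n) ≤ c^a P(N, n)` for all `a`, `N ≥ N₀`, `n ≥ c₀ 2^a N`
(Grimmett–Manolescu 2014, §8.3: "(exp_equiv_b) … iterated").
[cite: GrimmettManolescu2014Isoradial, §8.2 Prop. 23 (b) and §8.3 proof of Lemma 24 (iteration)] -/
theorem iterate_inner {P : ℕ → ℕ → ℝ} {c : ℝ} (hc : 0 ≤ c) {N₀ c₀ : ℕ}
    (hb : ∀ N n : ℕ, N₀ ≤ N → c₀ * N ≤ n → P (2 * N) n ≤ c * P N n) :
    ∀ a N n : ℕ, N₀ ≤ N → c₀ * (2 ^ a * N) ≤ n → P (2 ^ a * N) n ≤ c ^ a * P N n := by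
  intro a
  induction a with
  | zero => intro N n _ _; simp
  | succ a ih =>
    intro N n hN hn
    have hle : 2 ^ a * N ≤ 2 ^ (a + 1) * N :=
      Nat.mul_le_mul_right N (Nat.pow_le_pow_right (by norm_num) (Nat.le_succ a))
    have hN' : N₀ ≤ 2 ^ a * N := hN.trans (Nat.le_mul_of_pos_left N (by positivity))
    have hn' : c₀ * (2 ^ a * N) ≤ n := (Nat.mul_le_mul_left c₀ hle).trans hn
    have h2 : P (2 ^ (a + 1) * N) n ≤ c * P (2 ^ a * N) n := by
      have e : 2 ^ (a + 1) * N = 2 * (2 ^ a * N) := by ring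
      rw [e]
      exact hb (2 ^ a * N) n hN' hn'
    calc P (2 ^ (a + 1) * N) n ≤ c * P (2 ^ a * N) n := h2
      _ ≤ c * (c ^ a * P N n) := mul_le_mul_of_nonneg_left (ih N n hN hn') hc
      _ = c ^ (a + 1) * P N n := by ring

/-- **"(exp_equiv_a)–(b) iterated" — removal of a bounded scale distortion.** Let `P(r, R)` be
monotone under shrinking of the annulus (`r ≤ r' ≤ R' ≤ R ⟹ P(r, R) ≤ P(r', R')`: the inclusion
halves of Prop. 23 (a), (b)) and satisfy the doubling bounds `P(N, n) ≤ c P(N, 2n)`,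
`P(2N, n) ≤ c P(N, n)` for `N ≥ N₀`, `n ≥ c₀ N` (their deep halves). Then for every integer
`L ≥ 1`, shrinking the annulus `(N, n)` to `(L N, ⌊n/L⌋)` gains at most the factor `c^{2L+1}`:
`P(L N, ⌊n/L⌋) ≤ c^{2L+1} P(N, n)` for `N ≥ max(N₀, 1)`, `n ≥ L 2^L (c₀ + 2) N`. (Route:
`L N ≤ 2^L N`, then `L` inner halvings, `L + 1` outer doublings, and `2^{L+1} ⌊n/L⌋ ≥ n`.) This
is the step "≤ c₃ c₄ P[A_k(N, n)] by (exp_equiv_a) and (exp_equiv_b), iterated" of the proofs of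
Lemmas 24, 26 and of Prop. 23 (c).
[cite: GrimmettManolescu2014Isoradial, §8.3 proof of Lemma 24 and §8.4 proof of Lemma 26 ("(exp_equiv_a) and (exp_equiv_b), iterated")] -/
theorem distortion {P : ℕ → ℕ → ℝ} {c : ℝ} (hc : 0 ≤ c) {N₀ c₀ : ℕ}
    (hmono : ∀ r r' R' R : ℕ, r ≤ r' → r' ≤ R' → R' ≤ R → P r R ≤ P r' R')
    (ha : ∀ N n : ℕ, N₀ ≤ N → c₀ * N ≤ n → P N n ≤ c * P N (2 * n))
    (hb : ∀ N n : ℕ, N₀ ≤ N → c₀ * N ≤ n → P (2 * N) n ≤ c * P N n)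
    {L : ℕ} (hL : 1 ≤ L) :
    ∀ N n : ℕ, N₀ ≤ N → 1 ≤ N → L * 2 ^ L * (c₀ + 2) * N ≤ n →
      P (L * N) (n / L) ≤ c ^ (2 * L + 1) * P N n := by
  intro N n hN hN1 hn
  have hL0 : 0 < L := hL
  have hLpow : L ≤ 2 ^ L := (Nat.lt_two_pow_self).le
  set m := n / L with hm
  -- (i) `2^L N ≤ m`, (ii) `c₀ (2^L N) ≤ m`, (iii) `c₀ N ≤ m`
  have h1 : 2 ^ L * N ≤ m := by
    rw [hm, Nat.le_div_iff_mul_le hL0]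
    calc 2 ^ L * N * L = L * 2 ^ L * 1 * N := by ring
      _ ≤ L * 2 ^ L * (c₀ + 2) * N := by gcongr; omega
      _ ≤ n := hn
  have h2 : c₀ * (2 ^ L * N) ≤ m := by
    rw [hm, Nat.le_div_iff_mul_le hL0]
    calc c₀ * (2 ^ L * N) * L = L * 2 ^ L * c₀ * N := by ring
      _ ≤ L * 2 ^ L * (c₀ + 2) * N := by gcongr; omega
      _ ≤ n := hn
  have h3 : c₀ * N ≤ m :=
    le_trans (Nat.mul_le_mul_left c₀ (Nat.le_mul_of_pos_left N (by positivity))) h2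
  -- (iv) `n ≤ 2^{L+1} m`
  have hm1 : 1 ≤ m := le_trans (le_trans hN1 (Nat.le_mul_of_pos_left N (by positivity))) h1
  have h4 : n ≤ 2 ^ (L + 1) * m := by
    have hlt : n < m * L + L := Nat.lt_div_mul_add hL0
    have e : 2 ^ (L + 1) * m = 2 * (2 ^ L * m) := by ring
    rw [e]
    have : m * L + L ≤ 2 * (2 ^ L * m) + 1 := by
      have h5 : m * L ≤ 2 ^ L * m := by rw [mul_comm]; exact Nat.mul_le_mul_right m hLpow
      have h6 : L ≤ 2 ^ L * m := by
        calc L ≤ 2 ^ L := hLpow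
          _ = 2 ^ L * 1 := (mul_one _).symm
          _ ≤ 2 ^ L * m := Nat.mul_le_mul_left _ hm1
      omega
    omega
  have hNn : N ≤ n :=
    le_trans (le_trans (Nat.le_mul_of_pos_left N (by positivity)) h1) (Nat.div_le_self n L)
  -- the chain
  calc P (L * N) m ≤ P (2 ^ L * N) m :=
        hmono (L * N) (2 ^ L * N) m m (Nat.mul_le_mul_right N hLpow) h1 le_rfl
    _ ≤ c ^ L * P N m := iterate_inner hc hb L N m hN h2
    _ ≤ c ^ L * (c ^ (L + 1) * P N (2 ^ (L + 1) * m)) :=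
        mul_le_mul_of_nonneg_left (iterate_outer hc ha (L + 1) N m hN h3) (pow_nonneg hc L)
    _ = c ^ (2 * L + 1) * P N (2 ^ (L + 1) * m) := by ring
    _ ≤ c ^ (2 * L + 1) * P N n :=
        mul_le_mul_of_nonneg_left (hmono N N n (2 ^ (L + 1) * m) le_rfl hNn h4)
          (pow_nonneg hc _)

end ArmIteration

/-! ### The distortion lemma for the alternating arm probabilities of one graph -/

section OneGraph

variable {V F : Type*} [Countable V] {G : SimpleGraph V} (emb : RhombicEmbedding G F)

/-- **Removal of scale distortion for `P_G[A_{2j}(N, n)]`, given Prop. 23 (a), (b) for `G`.**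
If the alternating arm probabilities of an isoradially embedded graph satisfy the deep halves of
Grimmett–Manolescu's Prop. 23 (a), (b) — `P_G[A(N, n)] ≤ c P_G[A(N, 2n)]` and
`P_G[A(2N, n)] ≤ c P_G[A(N, n)]` for `N ≥ N₀`, `n ≥ c₀ N` — then, the inclusion halves being
`RhombicEmbedding.embAltArmProb_mono_annulus`, for every integer `L ≥ 1`:
`P_G[A(L N, ⌊n/L⌋)] ≤ c^{2L+1} P_G[A(N, n)]` for `N ≥ max(N₀, 1)`, `n ≥ L 2^L (c₀ + 2) N`.
[cite: GrimmettManolescu2014Isoradial, §8.2 Prop. 23 (a)–(b) and §8.3–8.4 ("iterated")] -/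
theorem _root_.Literature.Probability.LatticeModels.RhombicEmbedding.embAltArmProb_distortion
    (hiso : emb.IsIsoradial) (j : ℕ) {c : ℝ} (hc : 0 ≤ c) {N₀ c₀ : ℕ}
    (ha : ∀ N n : ℕ, N₀ ≤ N → c₀ * N ≤ n →
      emb.isoradialPercolation.real (emb.embAltArmEvent j N n) ≤
        c * emb.isoradialPercolation.real (emb.embAltArmEvent j N (2 * n)))
    (hb : ∀ N n : ℕ, N₀ ≤ N → c₀ * N ≤ n →
      emb.isoradialPercolation.real (emb.embAltArmEvent j (2 * N) n) ≤
        c * emb.isoradialPercolation.real (emb.embAltArmEvent j N n))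
    {L : ℕ} (hL : 1 ≤ L) {N n : ℕ} (hN : N₀ ≤ N) (hN1 : 1 ≤ N)
    (hn : L * 2 ^ L * (c₀ + 2) * N ≤ n) :
    emb.isoradialPercolation.real (emb.embAltArmEvent j (L * N) (n / L)) ≤
      c ^ (2 * L + 1) * emb.isoradialPercolation.real (emb.embAltArmEvent j N n) :=
  ArmIteration.distortion (P := fun r R => emb.isoradialPercolation.real (emb.embAltArmEvent j r R))
    hc (fun _ _ _ _ h₁ h₂ h₃ => emb.embAltArmProb_mono_annulus hiso j h₁ h₂ h₃) ha hb hL N n hN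
    hN1 hn

end OneGraph

/-! ### Prop. 22 for `k = 2j ≥ 4` from Prop. 23 (a), (b) and the raw transport -/

/-- **Grimmett–Manolescu 2014, §8.1: Prop. 22 (`exp_transport`, `k = 2j ≥ 4`) assembled from the
intermediate results of §8, in the tree's rendering.** Hypotheses (both binder types, not named
facts; neither is proved in the tree — see the module docstring):
(E) Prop. 23 (a), (b), second inequalities, for `embAltArmEvent j`, constants uniform over the
centred graphs of `𝒢(ε, I)`; (Tr) the raw, scale-distorted output of the star–triangle
transport (Lemma 26 composed with Cor. 25, before "(exp_equiv_a) and (exp_equiv_b), iterated"):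
comparability of `P_G[A(N, n)]` with `P_{ℤ²}[A(L N, ⌊n/L⌋)]` in both directions, for an integer
distortion factor `L = L(ε, I, j) ≥ 1`. Conclusion: the named fact
`GrimmettManolescu2014_altArmComparability`. Constants: `c₂ = C c'^{2L+1}` from (E) for
`ℤ² ∈ 𝒢(π/4, 1)`, `c₁ = (C c^{2L+1})⁻¹` from (E) for `𝒢(ε, I)`.
[cite: GrimmettManolescu2014Isoradial, §8.1 Prop. 22; §8.4 ("This lemma, together with Corollary 25, implies Proposition 22"); §8.3–8.4 ("(exp_equiv_a) and (exp_equiv_b), iterated")] -/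
theorem GrimmettManolescu2014_altArmComparability.of_equiv_of_transport
    (hE : ∀ (ε : ℝ), 0 < ε → ∀ (I j : ℕ), 2 ≤ j → ∃ c > (0 : ℝ), ∃ c₀ : ℕ, 1 ≤ c₀ ∧ ∃ N₀ : ℕ,
      ∀ (V F : Type) [Countable V] [DecidableEq V] [DecidableEq F] (G : SimpleGraph V)
        [G.LocallyFinite] (emb : RhombicEmbedding G F),
        G.Preconnected → emb.IsIsoradial → emb.IsRhombicTiling → emb.HasBoundedAngles ε →
        emb.SquareGridPropertyGM I → ((∃ v : V, emb.z v = 0) ∨ (∃ f : F, emb.c f = 0)) →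
        ∀ N n : ℕ, N₀ ≤ N → c₀ * N ≤ n →
          emb.isoradialPercolation.real (emb.embAltArmEvent j N n) ≤
              c * emb.isoradialPercolation.real (emb.embAltArmEvent j N (2 * n)) ∧
            emb.isoradialPercolation.real (emb.embAltArmEvent j (2 * N) n) ≤
              c * emb.isoradialPercolation.real (emb.embAltArmEvent j N n))
    (hT : ∀ (ε : ℝ), 0 < ε → ∀ (I j : ℕ), 2 ≤ j → ∃ L : ℕ, 1 ≤ L ∧ ∃ C > (0 : ℝ), ∃ c₀ : ℕ,
      1 ≤ c₀ ∧ ∃ N₀ : ℕ,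
      ∀ (V F : Type) [Countable V] [DecidableEq V] [DecidableEq F] (G : SimpleGraph V)
        [G.LocallyFinite] (emb : RhombicEmbedding G F),
        G.Preconnected → emb.IsIsoradial → emb.IsRhombicTiling → emb.HasBoundedAngles ε →
        emb.SquareGridPropertyGM I → ((∃ v : V, emb.z v = 0) ∨ (∃ f : F, emb.c f = 0)) →
        ∀ N n : ℕ, N₀ ≤ N → c₀ * N ≤ n →
          emb.isoradialPercolation.real (emb.embAltArmEvent j N n) ≤
              C * squareLatticeEmbedding.isoradialPercolation.real
                (squareLatticeEmbedding.embAltArmEvent j (L * N) (n / L)) ∧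
            squareLatticeEmbedding.isoradialPercolation.real
                (squareLatticeEmbedding.embAltArmEvent j N n) ≤
              C * emb.isoradialPercolation.real (emb.embAltArmEvent j (L * N) (n / L))) :
    GrimmettManolescu2014_altArmComparability := by
  intro ε hε I j hj
  obtain ⟨c, hc, c₀E, -, N₀E, HE⟩ := hE ε hε I j hj
  obtain ⟨c', hc', c₀E', -, N₀E', HE'⟩ := hE (Real.pi / 4) (by positivity) 1 j hj
  obtain ⟨L, hL, C, hC, c₀T, hc₀T, N₀T, HT⟩ := hT ε hε I j hj
  -- `ℤ²` is a centred member of `𝒢(π/4, 1)`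
  have hconn₀ : (zdGraph 2).Preconnected := zdGraph_preconnected_holds
  have hiso₀ : squareLatticeEmbedding.IsIsoradial := isIsoradial_squareLatticeEmbedding_holds
  have hrh₀ : squareLatticeEmbedding.IsRhombicTiling := isRhombicTiling_squareLatticeEmbedding_holds
  have hbap₀ : squareLatticeEmbedding.HasBoundedAngles (Real.pi / 4) :=
    hasBoundedAngles_squareLatticeEmbedding_holds le_rfl
  have hsgp₀ : squareLatticeEmbedding.SquareGridPropertyGM 1 := squareGridPropertyGM_squareLattice
  have h0₀ : (∃ v : Site 2, squareLatticeEmbedding.z v = 0) ∨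
      (∃ f : Site 2, squareLatticeEmbedding.c f = 0) := Or.inl ⟨0, squareLatticeEmbedding_z_zero⟩
  -- constants
  set K : ℝ := c ^ (2 * L + 1) with hK
  set K' : ℝ := c' ^ (2 * L + 1) with hK'
  have hKpos : 0 < K := pow_pos hc _
  have hK'pos : 0 < K' := pow_pos hc' _
  set c₀m : ℕ := max c₀E c₀E' with hc₀m
  refine ⟨(C * K)⁻¹, by positivity, C * K', by positivity, max c₀T (L * 2 ^ L * (c₀m + 2)),
    le_max_of_le_left hc₀T, max (max N₀T 1) (max N₀E N₀E'), ?_⟩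
  intro V F _ _ _ G _ emb hconn hiso hrh hbap hsgp h0 N n hN hn
  -- unpack the thresholds
  have hNT : N₀T ≤ N := le_trans (le_trans (le_max_left _ _) (le_max_left _ _)) hN
  have hN1 : 1 ≤ N := le_trans (le_trans (le_max_right _ _) (le_max_left _ _)) hN
  have hNE : N₀E ≤ N := le_trans (le_trans (le_max_left _ _) (le_max_right _ _)) hN
  have hNE' : N₀E' ≤ N := le_trans (le_trans (le_max_right _ _) (le_max_right _ _)) hN
  have hnT : c₀T * N ≤ n := le_trans (Nat.mul_le_mul_right N (le_max_left _ _)) hn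
  have hnL : L * 2 ^ L * (c₀m + 2) * N ≤ n := le_trans (Nat.mul_le_mul_right N (le_max_right _ _)) hn
  have hnE : L * 2 ^ L * (c₀E + 2) * N ≤ n := by
    refine le_trans (Nat.mul_le_mul_right N ?_) hnL
    gcongr
    exact le_max_left _ _
  have hnE' : L * 2 ^ L * (c₀E' + 2) * N ≤ n := by
    refine le_trans (Nat.mul_le_mul_right N ?_) hnL
    gcongr
    exact le_max_right _ _
  -- the raw transport at `(N, n)`
  obtain ⟨hup, hlow⟩ := HT V F G emb hconn hiso hrh hbap hsgp h0 N n hNT hnT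
  -- distortion removal on `ℤ²` (upper bound) and on `G` (lower bound)
  have hdist₀ : squareLatticeEmbedding.isoradialPercolation.real
        (squareLatticeEmbedding.embAltArmEvent j (L * N) (n / L)) ≤
      K' * squareLatticeEmbedding.isoradialPercolation.real
        (squareLatticeEmbedding.embAltArmEvent j N n) :=
    squareLatticeEmbedding.embAltArmProb_distortion hiso₀ j hc'.le
      (fun N n hN hn => (HE' _ _ (zdGraph 2) squareLatticeEmbedding hconn₀ hiso₀ hrh₀ hbap₀ hsgp₀
        h0₀ N n hN hn).1)
      (fun N n hN hn => (HE' _ _ (zdGraph 2) squareLatticeEmbedding hconn₀ hiso₀ hrh₀ hbap₀ hsgp₀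
        h0₀ N n hN hn).2)
      hL hNE' hN1 hnE'
  have hdist : emb.isoradialPercolation.real (emb.embAltArmEvent j (L * N) (n / L)) ≤
      K * emb.isoradialPercolation.real (emb.embAltArmEvent j N n) :=
    emb.embAltArmProb_distortion hiso j hc.le
      (fun N n hN hn => (HE V F G emb hconn hiso hrh hbap hsgp h0 N n hN hn).1)
      (fun N n hN hn => (HE V F G emb hconn hiso hrh hbap hsgp h0 N n hN hn).2)
      hL hNE hN1 hnE
  set PG := emb.isoradialPercolation.real (emb.embAltArmEvent j N n) with hPG
  set P₀ := squareLatticeEmbedding.isoradialPercolation.real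
    (squareLatticeEmbedding.embAltArmEvent j N n) with hP₀
  constructor
  · -- lower bound: `P₀ ≤ C P_G(LN, n/L) ≤ C K P_G`
    have h : P₀ ≤ C * K * PG :=
      calc P₀ ≤ C * emb.isoradialPercolation.real (emb.embAltArmEvent j (L * N) (n / L)) := hlow
        _ ≤ C * (K * PG) := mul_le_mul_of_nonneg_left hdist hC.le
        _ = C * K * PG := by ring
    have hCK : 0 < C * K := by positivity
    calc (C * K)⁻¹ * P₀ ≤ (C * K)⁻¹ * (C * K * PG) :=
          mul_le_mul_of_nonneg_left h (inv_nonneg.2 hCK.le)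
      _ = PG := by field_simp
  · -- upper bound: `P_G ≤ C P₀(LN, n/L) ≤ C K' P₀`
    calc PG ≤ C * squareLatticeEmbedding.isoradialPercolation.real
          (squareLatticeEmbedding.embAltArmEvent j (L * N) (n / L)) := hup
      _ ≤ C * (K' * P₀) := mul_le_mul_of_nonneg_left hdist₀ hC.le
      _ = C * K' * P₀ := by ring

/-- **Conversely, `T` gives the transport hypothesis (Tr) of `of_equiv_of_transport` with no
distortion (`L = 1`, `C = max(c₂, c₁⁻¹)`)**: the reduction is tight. (Bookkeeping.)
[cite: GrimmettManolescu2014Isoradial, §8.1 Prop. 22] -/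
theorem GrimmettManolescu2014_altArmComparability.transport_of
    (h : GrimmettManolescu2014_altArmComparability) (ε : ℝ) (hε : 0 < ε) (I j : ℕ) (hj : 2 ≤ j) :
    ∃ L : ℕ, 1 ≤ L ∧ ∃ C > (0 : ℝ), ∃ c₀ : ℕ, 1 ≤ c₀ ∧ ∃ N₀ : ℕ,
      ∀ (V F : Type) [Countable V] [DecidableEq V] [DecidableEq F] (G : SimpleGraph V)
        [G.LocallyFinite] (emb : RhombicEmbedding G F),
        G.Preconnected → emb.IsIsoradial → emb.IsRhombicTiling → emb.HasBoundedAngles ε →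
        emb.SquareGridPropertyGM I → ((∃ v : V, emb.z v = 0) ∨ (∃ f : F, emb.c f = 0)) →
        ∀ N n : ℕ, N₀ ≤ N → c₀ * N ≤ n →
          emb.isoradialPercolation.real (emb.embAltArmEvent j N n) ≤
              C * squareLatticeEmbedding.isoradialPercolation.real
                (squareLatticeEmbedding.embAltArmEvent j (L * N) (n / L)) ∧
            squareLatticeEmbedding.isoradialPercolation.real
                (squareLatticeEmbedding.embAltArmEvent j N n) ≤
              C * emb.isoradialPercolation.real (emb.embAltArmEvent j (L * N) (n / L)) := by
  obtain ⟨c₁, hc₁, c₂, hc₂, c₀, hc₀, N₀, H⟩ := h ε hε I j hj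
  refine ⟨1, le_rfl, max c₂ c₁⁻¹, lt_max_of_lt_left hc₂, c₀, hc₀, N₀, ?_⟩
  intro V F _ _ _ G _ emb hconn hiso hrh hbap hsgp h0 N n hN hn
  obtain ⟨h1, h2⟩ := H V F G emb hconn hiso hrh hbap hsgp h0 N n hN hn
  simp only [one_mul, Nat.div_one]
  refine ⟨h2.trans (mul_le_mul_of_nonneg_right (le_max_left _ _) measureReal_nonneg), ?_⟩
  -- `P₀ ≤ c₁⁻¹ P_G ≤ max(c₂, c₁⁻¹) P_G`
  have h3 : squareLatticeEmbedding.isoradialPercolation.real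
      (squareLatticeEmbedding.embAltArmEvent j N n) ≤
      c₁⁻¹ * emb.isoradialPercolation.real (emb.embAltArmEvent j N n) := by
    rw [le_inv_mul_iff₀ hc₁]
    exact h1
  exact h3.trans (mul_le_mul_of_nonneg_right (le_max_right _ _) measureReal_nonneg)

end Literature.Probability.Percolation

end
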